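import Summits.BirchSwinnertonDyer.BirchSwinnertonDyer.Theorems.ByReductionTypeAtTwoGoodOrdTowerControlDevissage
import HarnessLib

set_option linter.dupNamespace false -- `…BirchSwinnertonDyer.BirchSwinnertonDyer…` is the cell's nested layout (D-0017)
set_option autoImplicit false

/-!
# Greenberg LNM 1716 Lemma 3.4 at `n = 0`, the EXACT dévissage of the coinvariants along the reduction map:
# `#(M/DM)[p^∞] = #(M₁/D₁M₁)[p^∞] · #r(M)[p^∞]`

Seat `bsd-inputs-k4-p1` (gen 5; LADDER-BSD D-0154 KEY (147)(f) «prove the printed input», row 1 K4 INPUTS; Greenberg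
1999), `--supports stmt-BirchSwinnertonDyer-20309`. PURE ALGEBRA, THEOREMS ONLY (no definition, no named fact, no
`sorry`).

R. Greenberg, *Iwasawa theory for elliptic curves*, LNM 1716 (1999), §3 Lemma 3.4 (p. 89): at a good ordinary `v ∣ p`,
`|ker(r_v)| = |Ẽ(𝔽_p)_p|²`, the two factors being `|ker(a_v)| = |Im λ_v / Im κ_v|` (Prop. 2.5) and
`|ker(d_v)| = |H¹(Γ, Ẽ(f)_p)|`. In the tree's POINTS currency (`𝒦_{v,0}[p^∞] ≅ (M/(g−1)M)[p^∞]`, `M = E(K̄_v)^{H_∞}`,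
cells b2b-bsdres / bsd-2adic) the same factorisation is a dévissage of the coinvariants of `M` along the reduction map
`r = red₀|_M : M → Ẽ`, whose kernel is `M₁ = Ê(𝔪̄)^{H_∞}`: the bsd-2adic BRICK A′
(`GoodOrdTower.natCard_torsionBy_quotient_le_mul_card_range`) is the INEQUALITY `#(M/DM)[m] ≤ #(M₁/D₁M₁)[m] · #r(M)`.
This file proves the EQUALITY on `p`-primary parts,

* `natCard_primaryComponent_quotient_eq_mul` — for an additive group `M` with an endomorphism `D` («`g − 1`»), an
  additive `r : M → T` with `r ∘ D = 0`, FINITE image and invariant lifts (`∀ x ∃ x₀, D x₀ = 0 ∧ r x₀ = r x` — Hensel: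
  `E(K_v) ↠ Ẽ(k)`), an injective `j : M₁ → M` onto `ker r` with `j ∘ D₁ = D ∘ j`, and the COINVARIANT VANISHING
  «`(M ⊗ ℚ_p/ℤ_p)_Γ = 0`» spelled out on elements (`hcoinv`: `∀ x k ∃ j m R t, p^e t = 0 ∧ p^j x = D m + p^{k+j} R + t`
  — Greenberg p. 108 "looking at the maps `λ_v`", the tree's `InputsGreenbergLocalAtP.coinvInput_of_formalH2_of_coatesGreenberg`):
  if `(M₁/D₁M₁)[p^∞]` is finite then `(M/DM)[p^∞]` is finite and
  **`#(M/DM)[p^∞] = #(M₁/D₁M₁)[p^∞] · #r(M)[p^∞]`**.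

Proof: `r` descends to `r̄ : M/DM → T`; `M₁/D₁M₁ → M/DM` is injective (invariant lifts) with image `ker r̄`; on the
`p`-primary part `P` of `M/DM`, `ker(r̄|_P) ≅ (M₁/D₁M₁)[p^∞]` and `r̄(P) = r(M)[p^∞]` — the inclusion `⊇` is where
`hcoinv` enters: for `y = r x` killed by `p^k`, writing `#r(M) = p^s u` with `p ∤ u` and `p^j (u x) = D m + p^{s+j} R + t`,
the class of `u² x − p^s u R` is `p`-power torsion and reduces to `u² y`, and `u²` permutes `r(M)[p^∞]`.

HONEST FRAMING: an algebra lemma; closes nothing; no summit statement is proved; BSD is not proved by any of this.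

References: [GreenbergLNM1716] §2 Prop. 2.5 (p. 80), §3 Lemma 3.4 (p. 89), §4 p. 108.
-/

noncomputable section

open scoped Classical

universe u v w

namespace Summit.BirchSwinnertonDyer.BirchSwinnertonDyer.Theorems.InputsGreenbergLemma34

variable {M : Type u} {M₁ : Type v} {T : Type w} [AddCommGroup M] [AddCommGroup M₁] [AddCommGroup T]

/-- Bookkeeping: multiplication by `u` prime to `p` is a bijection on a finite group each of whose elements is killed
by a power of `p`. [folklore] -/
private theorem nsmul_bijective_of_coprime {A : Type*} [AddCommGroup A] [Finite A] (p : ℕ) [hp : Fact p.Prime]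
    (hA : ∀ a : A, ∃ k : ℕ, p ^ k • a = 0) {u : ℕ} (hu : ¬ p ∣ u) :
    Function.Bijective fun a : A ↦ u • a := by
  refine Finite.injective_iff_bijective.mp fun a b hab ↦ ?_
  have h : u • (a - b) = 0 := by
    have hab' : u • a = u • b := hab
    rw [smul_sub, hab', sub_self]
  obtain ⟨k, hk⟩ := hA (a - b)
  have hcop : Nat.Coprime u (p ^ k) :=
    (Nat.Coprime.pow_right _ ((Nat.Prime.coprime_iff_not_dvd hp.out).mpr hu).symm)
  have hord : addOrderOf (a - b) ∣ Nat.gcd u (p ^ k) :=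
    Nat.dvd_gcd (addOrderOf_dvd_of_nsmul_eq_zero h) (addOrderOf_dvd_of_nsmul_eq_zero hk)
  rw [hcop, Nat.dvd_one, AddMonoid.addOrderOf_eq_one_iff] at hord
  exact sub_eq_zero.mp hord

/-- **Exact dévissage of the `p`-primary coinvariants along a map with invariant lifts, finite image and vanishing
`ℚ_p/ℤ_p`-coinvariants** (the points-currency form of Greenberg's `|ker(r_v)| = |ker(a_v)| · |ker(d_v)|`, LNM 1716 §3
Lemma 3.4, p. 89). `M` an additive group with an endomorphism `D`; `r : M → T` additive with `r ∘ D = 0`, finite image,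
invariant lifts (`hlift`); `j : M₁ ↪ M` onto `ker r` with `j ∘ D₁ = D ∘ j`; and (`hcoinv`) for every `x` and `k` there
are `j, m, R` and a `p`-power-torsion `t` with `p^j x = D m + p^{k+j} R + t`. If `(M₁/D₁M₁)[p^∞]` is finite, then
`(M/DM)[p^∞]` is finite and `#(M/DM)[p^∞] = #(M₁/D₁M₁)[p^∞] · #r(M)[p^∞]`. See the module docstring for the proof.
[cite: GreenbergLNM1716, §3 Lemma 3.4 (p. 89) and §2 Prop. 2.5 (p. 80)] -/
theorem natCard_primaryComponent_quotient_eq_mul (p : ℕ) [hp : Fact p.Prime]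
    (D : M →+ M) (r : M →+ T) (hrD : ∀ x, r (D x) = 0)
    [Finite r.range] (hlift : ∀ x : M, ∃ x₀ : M, D x₀ = 0 ∧ r x₀ = r x)
    (hcoinv : ∀ (x : M) (k : ℕ), ∃ (i : ℕ) (m R t : M), (∃ e : ℕ, p ^ e • t = 0) ∧
      p ^ i • x = D m + p ^ (k + i) • R + t)
    (j : M₁ →+ M) (hj : Function.Injective j) (hjr : ∀ x, r (j x) = 0) (hrj : ∀ y, r y = 0 → ∃ x, j x = y)
    (D₁ : M₁ →+ M₁) (hD₁ : ∀ x, j (D₁ x) = D (j x))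
    [Finite (AddCommGroup.primaryComponent (M₁ ⧸ D₁.range) p)] :
    Finite (AddCommGroup.primaryComponent (M ⧸ D.range) p) ∧
      Nat.card (AddCommGroup.primaryComponent (M ⧸ D.range) p) =
        Nat.card (AddCommGroup.primaryComponent (M₁ ⧸ D₁.range) p) *
          Nat.card (AddCommGroup.primaryComponent r.range p) := by
  -- notation
  let Q := M ⧸ D.range
  let Q₁ := M₁ ⧸ D₁.range
  -- `r` descends to `r̄ : M/DM → T`
  have hle : D.range ≤ r.ker := by
    rintro _ ⟨x, rfl⟩
    exact (AddMonoidHom.mem_ker).mpr (hrD x)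
  let rbar : Q →+ T := QuotientAddGroup.lift D.range r hle
  have hrbar : ∀ x : M, rbar (QuotientAddGroup.mk x) = r x := fun x ↦ QuotientAddGroup.lift_mk' _ _ x
  -- the map `ι : M₁/D₁M₁ → M/DM` induced by `j`, injective by the invariant lifts
  have hle₁ : D₁.range ≤ D.range.comap j := by
    rintro _ ⟨x, rfl⟩
    exact ⟨j x, (hD₁ x).symm⟩
  let ι : Q₁ →+ Q := QuotientAddGroup.map D₁.range D.range j hle₁
  have hι : ∀ x : M₁, ι (QuotientAddGroup.mk x) = QuotientAddGroup.mk (j x) := fun x ↦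
    QuotientAddGroup.map_mk' _ _ _ _ x
  have hιinj : Function.Injective ι := by
    refine (injective_iff_map_eq_zero ι).mpr fun c hc ↦ ?_
    obtain ⟨x, rfl⟩ := QuotientAddGroup.mk_surjective c
    rw [hι, QuotientAddGroup.eq_zero_iff] at hc
    obtain ⟨y, hy⟩ := hc
    obtain ⟨y₀, hDy₀, hry₀⟩ := hlift y
    obtain ⟨y₁, hy₁⟩ := hrj (y - y₀) (by rw [map_sub, hry₀, sub_self])
    rw [QuotientAddGroup.eq_zero_iff]
    refine ⟨y₁, hj ?_⟩
    rw [hD₁, hy₁, map_sub, hDy₀, sub_zero, hy]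
  -- the `p`-primary parts
  let P : AddSubgroup Q := AddCommGroup.primaryComponent Q p
  have hP : ∀ c : Q, c ∈ P ↔ ∃ k : ℕ, p ^ k • c = 0 := fun c ↦ AddCommGroup.mem_primaryComponent
  let P₁ : AddSubgroup Q₁ := AddCommGroup.primaryComponent Q₁ p
  have hP₁ : ∀ c : Q₁, c ∈ P₁ ↔ ∃ k : ℕ, p ^ k • c = 0 := fun c ↦ AddCommGroup.mem_primaryComponent
  let A : AddSubgroup r.range := AddCommGroup.primaryComponent r.range p
  have hA : ∀ c : r.range, c ∈ A ↔ ∃ k : ℕ, p ^ k • c = 0 := fun c ↦ AddCommGroup.mem_primaryComponent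
  -- `φ = r̄|_P : P → T`; `#P = #range φ · #ker φ`
  let φ : P →+ T := rbar.comp P.subtype
  have hφ : ∀ c : P, φ c = rbar (c : Q) := fun _ ↦ rfl
  have hdec : Nat.card P = Nat.card (P ⧸ φ.ker) * Nat.card φ.ker :=
    AddSubgroup.card_eq_card_quotient_mul_card_addSubgroup _
  have hq : Nat.card (P ⧸ φ.ker) = Nat.card φ.range :=
    Nat.card_congr (QuotientAddGroup.quotientKerEquivRange φ).toEquiv
  -- (1) `ker φ ≃ P₁`
  have hker_mem : ∀ k : φ.ker, ∃ x : M₁, ι (QuotientAddGroup.mk x) = ((k : P) : Q) := by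
    intro k
    obtain ⟨x, hx⟩ := QuotientAddGroup.mk_surjective ((k : P) : Q)
    have hk0 : φ k = 0 := k.2
    have hrx : r x = 0 := by
      rw [hφ, ← hx, hrbar] at hk0
      exact hk0
    obtain ⟨x₁, rfl⟩ := hrj x hrx
    exact ⟨x₁, by rw [hι, hx]⟩
  have hker_prim : ∀ k : φ.ker, (QuotientAddGroup.mk (hker_mem k).choose : Q₁) ∈ P₁ := by
    intro k
    obtain ⟨n, hn⟩ := (hP _).mp (k : P).2
    refine (hP₁ _).mpr ⟨n, hιinj ?_⟩
    rw [map_nsmul, (hker_mem k).choose_spec, map_zero]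
    exact hn
  let ψ : φ.ker → P₁ := fun k ↦ ⟨QuotientAddGroup.mk (hker_mem k).choose, hker_prim k⟩
  have hψinj : Function.Injective ψ := by
    intro k k' h
    have h1 : (QuotientAddGroup.mk (hker_mem k).choose : Q₁) = QuotientAddGroup.mk (hker_mem k').choose :=
      congrArg Subtype.val h
    have h2 : ((k : P) : Q) = ((k' : P) : Q) := by
      rw [← (hker_mem k).choose_spec, ← (hker_mem k').choose_spec, h1]
    exact Subtype.ext (Subtype.ext h2)
  have hψsurj : Function.Surjective ψ := by
    intro c
    obtain ⟨x₁, hx₁⟩ := QuotientAddGroup.mk_surjective (c : Q₁)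
    obtain ⟨n, hn⟩ := (hP₁ _).mp c.2
    -- the class of `j x₁` in `P`, in the kernel of `φ`
    have hmemP : (QuotientAddGroup.mk (j x₁) : Q) ∈ P := by
      refine (hP _).mpr ⟨n, ?_⟩
      rw [← hι, ← map_nsmul, hx₁, hn, map_zero]
    have hmemK : (⟨_, hmemP⟩ : P) ∈ φ.ker := by
      rw [AddMonoidHom.mem_ker, hφ]
      change rbar (QuotientAddGroup.mk (j x₁)) = 0
      rw [hrbar, hjr]
    refine ⟨⟨_, hmemK⟩, Subtype.ext ?_⟩
    change (QuotientAddGroup.mk (hker_mem ⟨_, hmemK⟩).choose : Q₁) = (c : Q₁)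
    apply hιinj
    rw [(hker_mem ⟨_, hmemK⟩).choose_spec, ← hx₁, hι]
  have hker : Nat.card φ.ker = Nat.card P₁ := Nat.card_congr (Equiv.ofBijective ψ ⟨hψinj, hψsurj⟩)
  haveI hker_fin : Finite φ.ker := Finite.of_injective ψ hψinj
  -- (2) `range φ = r(M)[p^∞]` (as subsets of `T`)
  have hrange_le : ∀ y, y ∈ φ.range → ∃ hy : y ∈ r.range, (⟨y, hy⟩ : r.range) ∈ A := by
    rintro _ ⟨c, rfl⟩
    obtain ⟨x, hx⟩ := QuotientAddGroup.mk_surjective ((c : P) : Q)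
    obtain ⟨n, hn⟩ := (hP _).mp (c : P).2
    have hval : φ c = r x := by rw [hφ, ← hx, hrbar]
    refine ⟨⟨x, hval.symm⟩, (hA _).mpr ⟨n, Subtype.ext ?_⟩⟩
    rw [AddSubmonoidClass.coe_nsmul, ZeroMemClass.coe_zero]
    change p ^ n • φ c = 0
    rw [← map_nsmul, hφ, AddSubmonoidClass.coe_nsmul, hn, map_zero]
  -- `#r(M) = p^s u`, `p ∤ u`
  obtain ⟨s, u, hu, hsu⟩ := Nat.exists_eq_pow_mul_and_not_dvd (Nat.card_pos (α := r.range)).ne' p hp.out.ne_one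
  have hkill : ∀ y : r.range, p ^ s • (u • y) = 0 := fun y ↦ by
    rw [← mul_smul, ← hsu]; exact card_nsmul_eq_zero'
  have hAprim : ∀ a : A, ∃ k : ℕ, p ^ k • a = 0 := fun a ↦ by
    obtain ⟨k, hk⟩ := (hA _).mp a.2
    exact ⟨k, Subtype.ext (by rw [AddSubmonoidClass.coe_nsmul, hk, ZeroMemClass.coe_zero])⟩
  haveI : Finite A := inferInstance
  have hbij := nsmul_bijective_of_coprime p hAprim (u := u * u) (fun h ↦ by
    rcases (Nat.Prime.dvd_mul hp.out).mp h with h | h <;> exact hu h)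
  have hrange_ge : ∀ y : r.range, y ∈ A → (y : T) ∈ φ.range := by
    intro y hy
    -- `y = (u * u) • y₀` with `y₀ ∈ A`
    obtain ⟨y₀, hy₀⟩ := hbij.2 ⟨y, hy⟩
    have hy₀' : (u * u) • ((y₀ : A) : r.range) = y := by
      have h := congrArg (fun z : A ↦ (z : r.range)) hy₀
      simpa only [AddSubmonoidClass.coe_nsmul] using h
    obtain ⟨x, hx⟩ := ((y₀ : A) : r.range).2
    -- `p^i (u x) = D m + p^(s+i) R + t`
    obtain ⟨i, m, R, t, ⟨e, hte⟩, heq⟩ := hcoinv (u • x) s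
    -- the class of `x'' = u (u x) − p^s (u R)` is `p`-power torsion and reduces to `(u*u) y₀`
    set x'' : M := u • (u • x) - p ^ s • (u • R) with hx''
    have htors : p ^ (i + e) • (QuotientAddGroup.mk x'' : Q) = 0 := by
      rw [← QuotientAddGroup.mk_nsmul, QuotientAddGroup.eq_zero_iff]
      refine ⟨p ^ e • (u • m), ?_⟩
      have h1 : p ^ i • x'' = u • (D m) + u • t := by
        rw [hx'', smul_sub, smul_comm (p ^ i) u (u • x), heq, smul_add, smul_add, ← mul_smul (p ^ i) (p ^ s),
          ← pow_add, add_comm i s, smul_comm u (p ^ (s + i)) R]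
        abel
      rw [pow_add, mul_comm, mul_smul, h1, smul_add, smul_comm (p ^ e) u t, hte, smul_zero, add_zero,
        map_nsmul, map_nsmul, smul_comm]
    have hmemP : (QuotientAddGroup.mk x'' : Q) ∈ P := (hP _).mpr ⟨i + e, htors⟩
    refine ⟨⟨_, hmemP⟩, ?_⟩
    rw [hφ]
    change rbar (QuotientAddGroup.mk x'') = (y : T)
    rw [hrbar, hx'', map_sub, map_nsmul, map_nsmul, map_nsmul, map_nsmul, hx]
    have h2 : p ^ s • (u • r R) = 0 := by
      have h := congrArg (fun z : r.range ↦ (z : T)) (hkill ⟨r R, R, rfl⟩)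
      simpa only [AddSubmonoidClass.coe_nsmul, ZeroMemClass.coe_zero] using h
    rw [h2, sub_zero, ← mul_smul, ← hy₀']
    rfl
  -- `range φ ≃ A`
  let θ : φ.range → A := fun y ↦ ⟨⟨(y : T), (hrange_le y.1 y.2).choose⟩, (hrange_le y.1 y.2).choose_spec⟩
  have hθinj : Function.Injective θ := fun a b h ↦ Subtype.ext (congrArg (fun z : A ↦ ((z : r.range) : T)) h)
  have hθsurj : Function.Surjective θ := fun a ↦
    ⟨⟨((a : r.range) : T), hrange_ge (a : r.range) a.2⟩, Subtype.ext (Subtype.ext rfl)⟩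
  have hrange : Nat.card φ.range = Nat.card A := Nat.card_congr (Equiv.ofBijective θ ⟨hθinj, hθsurj⟩)
  haveI hrange_fin : Finite φ.range := Finite.of_injective θ hθinj
  -- finiteness of `P` and the count
  have hPcard : Nat.card P = Nat.card A * Nat.card P₁ := by rw [hdec, hq, hrange, hker]
  haveI hPfin : Finite P := by
    apply Nat.finite_of_card_ne_zero
    rw [hPcard]
    exact mul_ne_zero (Nat.card_pos (α := A)).ne' (Nat.card_pos (α := P₁)).ne'
  exact ⟨hPfin, by rw [hPcard, mul_comm]⟩

end Summit.BirchSwinnertonDyer.BirchSwinnertonDyer.Theorems.InputsGreenbergLemma34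

end
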